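import Literature.NumberTheory.EllipticCurves.Castella2018.PAdicWaldspurgerFormula
import HarnessLib

/-!
# Kriz–Li 2019, Theorem 1.16 (the main congruence between `p`-adic logarithms of Heegner points)
# at `m = 1`, with Remark 1.17 (the Euler-type factors `|Ẽ^{ns}(𝔽_ℓ)|/ℓ`)

Trunk T-NT-EC (`Literature/NumberTheory/EllipticCurves`), story `KrizLi2019/` (D. Kriz, C. Li,
*Goldfeld's conjecture and congruences between Heegner points*, Forum Math. Sigma **7** (2019) e15,
doi 10.1017/fms.2019.9; bib `KrizLi2019`). The `p = 2` applications (Thm. 4.3 / Thm. 5.1 (2)) are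
`TwoPartBSDTwists.lean`, the `p = 3` sextic-twist results are `SexticTwist*.lean`; the former file
records `-- TODO(general form): … the general congruence Thm. 1.16/3.9`, which THIS file vendors at
`m = 1` (any prime `p`, any reduction type at `p` on either curve). HONEST FRAMING (cell
`b2b-bsdres`, run/shared/lean/b2b/bsd-rank1-residual/): the goal of the cell is to DELETE the
COMBINATION-SHAPED residual classes of the Birch–Swinnerton-Dyer formula for ALL analytic-rank `≤ 1`
elliptic curves over `ℚ` from PUBLISHED theorems only; CONSTRUCTION-SHAPED classes are TYPED, not
attempted; this is not "finishing BSD". Literature seat `b2b-bsdres-lit` GEN 90 answering the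
by-name ask A-LIT-G21-1 of o5-r2 GEN 21 (HOME/INBOX.md l.13972): the by-name CONSUMER is the typed
node KL3-A `Summit.BirchSwinnertonDyer.Rank1Residual.O5.HeegnerLogTransport.KrizLiUnitBitTransportThree`
(`Summits/BirchSwinnertonDyer/Rank1Residual/O5/HeegnerLogTransportThree.lean` l. 166), the only typed
node on the path of the END `o5_index_unit_of_ordinary_companion_facts` (part 9). ONE named fact
(`def … : Prop`, nothing asserted; D-0014/D-0026 accounting: +1, consumer named), four definitions
with bodies (the READINGS of the printed symbols on tree objects; at `p = 3` they are, body for body,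
the O5 file's `nsCount` / `klSet` / `klExponent`), and PROVED API including the valuation corollary
that KL3-A states. No `sorry`.

## The printed statements (read by this seat on BOTH held texts: the published version
## `paper:doi-10-1017-fms-2019-9` (corpus-s2orc, 35 text chunks; displayed formulas dropped by the
## extractor) and the arXiv version `paper:arxiv-1606.03172` (corpus-tex, 21 text chunks, displays
## intact) — an EARLIER version titled "Congruences between Heegner points and quadratic twists of
## elliptic curves" whose numbering differs: arXiv Thm. 1.8 / Rem. 1.9 / Thm. 2.9 / Rem. 2.10 /
## Rem. 2.11 = FMS Thm. 1.16 / Rem. 1.17 / Thm. 3.9 / Rem. 3.10 / Rem. 3.11. Locators "chunk pNNNN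
## Lnn" below are 1-based 3000-character TEXT CHUNKS of the held copies, not PDF pages.)

§1.4 (FMS chunk p0002; arXiv §1.2 p0003 L66): "Let `E/ℚ` be an elliptic curve of conductor `N`. …
`K = ℚ(√d_K)` … an imaginary quadratic field of fundamental discriminant `d_K` satisfying the Heegner
hypothesis for `N`: each prime factor `ℓ` of `N` is split in `K`. We denote by `P ∈ E(K)` the
corresponding Heegner point, defined up to sign and torsion with respect to a fixed modular
parametrization `π_E : X₀(N) → E`. Let `f … ∈ S₂^{new}(Γ₀(N))` be the normalized newform associated
to `E`. Let `ω_E ∈ Ω¹_{E/ℚ}` such that `π_E^*(ω_E) = f(q) · dq/q`. We denote by `log_{ω_E}` the formal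
logarithm associated to `ω_E`. Notice `ω_E` may differ from the Néron differential by a scalar when
`E` is not the optimal curve in its isogeny class."

THEOREM 1.16 (FMS chunk p0002 = arXiv Thm. 1.8, chunk p0004 L3–L10, verbatim): "Let `E` and `E′` be
two elliptic curves over `ℚ` of conductors `N` and `N′` respectively. Suppose `p` is a prime such
that there is an isomorphism of semisimplified `G_ℚ := Gal(ℚ̄/ℚ)`-representations
`E[p^m]^{ss} ≅ E′[p^m]^{ss}` for some `m ≥ 1`. Let `K` be an imaginary quadratic field satisfying
the Heegner hypothesis for both `N` and `N′`. Let `P ∈ E(K)` and `P′ ∈ E′(K)` be the Heegner points.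
Assume `p` is split in `K`. Then we have
`(∏_{ℓ ∣ pNN′/M} |Ẽ^{ns}(𝔽_ℓ)|/ℓ) · log_{ω_E} P ≡ ± (∏_{ℓ ∣ pNN′/M} |Ẽ′^{ns}(𝔽_ℓ)|/ℓ) · log_{ω_{E′}} P′
(mod p^m 𝓞_{K_p})`. Here `M = ∏_{ℓ ∣ (N,N′), a_ℓ(E) ≡ a_ℓ(E′) (mod p^m)} ℓ^{ord_ℓ(NN′)}`."

REMARK 1.17 (FMS chunk p0002 = arXiv Rem. 1.9, p0004 L12–L13): "Recall that `Ẽ^{ns}(𝔽_ℓ)` denotes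
the number of `𝔽_ℓ`-points of the nonsingular part of the mod `ℓ` reduction of `E`, which is
`ℓ + 1 − a_ℓ(E)` if `ℓ ∤ N`, `ℓ ± 1` if `ℓ ∥ N` and `ℓ` if `ℓ² ∣ N`. The factors in the above congruence
can be understood as the result of removing the Euler factors of `L(E,1)` and `L(E′,1)` at bad
primes." The general form THEOREM 3.9 (FMS chunk p0009 = arXiv Thm. 2.9, p0011 L3–L12) makes the
factors explicit at `χ = 1`: `(ℓ − a_ℓ(f) + 1)/ℓ` for `ℓ ∤ N` and `(ℓ − a_ℓ(f))/ℓ` for `ℓ ∣ N`, i.e.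
`|Ẽ^{ns}(𝔽_ℓ)| = ℓ + [ℓ ∤ N] − a_ℓ(E)` with `a_ℓ(E)` the Dirichlet coefficient of `L(E, s)` (`±1`
at multiplicative, `0` at additive primes). Proof of Theorem 1.16 (FMS chunk p0011 L3): "It follows
immediately from Theorem 3.9 by taking `χ = 1`, `L = K`, and `f` and `g` to be associated with `E`
and `E′`. The Heegner points `P = P_f(1)` and `P′ = P_g(1)` are defined up to sign and torsion
depending on the choices of `𝔑` and `𝔑′`." REMARK 3.11 (FMS p0010): both sides depend on the
choices of `𝔑`, `𝔑′` up to a sign `±1`. REMARK 3.10 (FMS p0010 L21 = arXiv Rem. 2.10): "The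
normalizations of `ω_E` and `ω_{E′}` in the statement of Theorem 1.16 a priori imply that both sides
of Theorem 1.16 are `p`-integral. … Let `ω_𝓔` denote the canonical Néron differential of `E`, and
let `c ∈ ℤ` such that `ω_𝓔 = c · ω_E`. Note that the normalization of the `p`-adic formal logarithm
`log_{ω_E}` above differs by a factor of `c` from that of the normalization `log_E := log_{ω_𝓔}`."
§3.1 (FMS p0005 L15 = arXiv §2.1 p0006 L5), first sentence of the proof strategy: "From the
congruent Galois representations, we deduce that the coefficients of the associated modular forms
are congruent away from `pNN′`."

## Transcription (tree vocabulary; every hypothesis a binder)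

* `E`, `E′` = GLOBALLY MINIMAL models `W`, `G /ℚ` (`[IsGloballyMinimal]`, so that `ω_W` is the Néron
  differential `ω_𝓔` and the reduction of the model at every `ℓ` is the reduction of `E`);
  `N = W.conductorNorm ℤ`, `N′ = G.conductorNorm ℤ` ("of conductors `N` and `N′`"); `a_ℓ(E) =
  W.LFunction ℓ` (the Dirichlet coefficient, `= a_ℓ(f)` by `IsNewformOf`).
* "`E[p^m]^{ss} ≅ E′[p^m]^{ss}`", HERE AT `m = 1` ONLY, transcribed as what the proof uses (§3.1,
  quoted): `a_ℓ(E) ≡ a_ℓ(E′) (mod p)` for every prime `ℓ ∤ pNN′`. At `m = 1` this is EQUIVALENT to the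
  printed hypothesis (traces of Frobenius at the unramified primes determine the semisimplification:
  Chebotarev density + Brauer–Nesbitt, the determinants being the cyclotomic character on both
  sides) — a folklore equivalence, recorded, not used. -- TODO(general form): `m ≥ 2`
  (`mod p^m`, "semisimplified mod `p^m`"), and Thm. 3.9 (weight-2 eigenforms `f`, `g` with
  coefficients in a number field, `GL₂`-type `A_f`, `A_g`, a ring class character `χ`).
* `K`: `IsImaginaryQuadratic K`; Heegner hypothesis for `N` and for `N′`:
  `SatisfiesHeegnerHypothesis N K`, `SatisfiesHeegnerHypothesis N′ K` (`HeegnerPoints.lean`, "each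
  prime factor of `N` is split in `K`", the printed wording); "`p` is split in `K`": two primes of
  `𝓞 K` above `p` (the idiom of `TwoPartBSDTwists.InS`), AND an embedding `ιp : K →+* ℚ_p` (it exists
  exactly when `p` splits; it is the datum that reads `log_{ω_E} P ∈ K_𝔭 = ℚ_p`, both sides through
  the SAME `ιp`, as in the paper's fixed `K ↪ ℚ̄_p`).
* the parametrisations `π_E`, `π_{E′}` and the constants `c`: data `D : ModularParametrizationData W N`,
  `D′ : ModularParametrizationData G N′` at the conductor levels (`ModularCurve.lean`; `D.f` is the
  newform of `W` by `IsNewformOf`; `D.maninConstant = c` with `φ^* ω_𝓔 = c · 2πi f(τ) dτ`, i.e. the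
  printed `ω_𝓔 = c · ω_E` of Rem. 3.10), so that `log_{ω_E} P = log_{ω_𝓔} P / c`.
* the Heegner points: Heegner data `H : HeegnerDatum N d_K`, `H′ : HeegnerDatum N′ d_K` (the choices
  of `𝔑`, `𝔑′`; Thm. 1.16 as printed does not ask the compatibility `(ℓ, 𝔑) = (ℓ, 𝔑′)` of the general
  setting of §3 — its sign `±` and Rem. 3.11 absorb the choices), ONE complex embedding `ι : K →+* ℂ`
  and points `P ∈ W(K)`, `P′ ∈ G(K)` with `ι(P) = heegnerPointComplex D H`, `ι(P′) =
  heegnerPointComplex D′ H′` (the trace over `Cl(𝓞_K)` of the CM points `[𝔞 ⋆ (A, A[𝔑])] − [∞]`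
  pushed to `E`, §3 = the tree's `∑_{[Q]} φ(τ_Q)`; exactly the binders of the tree's `gross_zagier`).
  Torsion ambiguity is invisible to `log`; the sign ambiguity is the printed `±`.
* `log_{ω_𝓔} P ∈ ℚ_p` (Néron normalisation, extended `ℤ_p`-linearly to all of `E(ℚ_p)`) = the tree's
  `Castella2018.padicLogOmega W p ιp P` (`= log_W(z(m₀ • P_ιp))/m₀`, `m₀ = [E(ℚ_p) : E₁(ℚ_p)]`; its
  `ord_p` is the tree's `padicLogOrd`, `Castella2018.valuation_padicLogOmega`); hence the printed
  `log_{ω_E} P = padicLogOmega W p ιp P / D.maninConstant`.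
* `∏_{ℓ ∣ pNN′/M} |Ẽ^{ns}(𝔽_ℓ)|/ℓ ∈ ℚ` = `eulerFactor p W G` below, over the prime set
  `depletionPrimes p W G = {ℓ prime : ℓ ∣ pNN′/M}` = the primes `ℓ ∣ p·N·N′` with `ℓ = p` or NOT
  (`ℓ ∣ N ∧ ℓ ∣ N′ ∧ a_ℓ(E) ≡ a_ℓ(E′) (mod p)`) — `p` itself always divides `pNN′/M` because of the
  extra factor `p`; `|Ẽ^{ns}(𝔽_ℓ)| = nsPointCount W ℓ = ℓ + [good at ℓ] − a_ℓ(E)` (Rem. 1.17 in the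
  explicit form of Thm. 3.9 at `χ = 1`).
* "`≡ ± … (mod p 𝓞_{K_p})`", `K_p = ℚ_p`: `∃ ε ∈ {1, −1}`, `‖X − ε X′‖_p ≤ p⁻¹`.

FIDELITY VERDICT for the consumer (A-LIT-G21-1): KL3-A `KrizLiUnitBitTransportThree` is the
VALUATION COROLLARY of this fact at `p = 3` (`ord₃ X = 0 ↔ ord₃ X′ = 0`, which follows from
`X ∓ X′ ∈ 3ℤ₃` alone — `eulerFactorOrd_add_padicLogOrd_sub_eq_zero_iff_of_thm116` below, proved),
stated there at an arbitrary parametrisation level with the extra (weakening) binders `d_K < −4`,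
`3 ∤ d_K`, `P`, `P′` of infinite order; its `nsCount` / `klSet` / `klExponent` are `nsPointCount` /
`depletionPrimes 3` / `eulerFactorOrd 3` body for body. Nothing is asserted here: users take
`(h : thm116_padicLogHeegner_congruence)`.
-/

noncomputable section

open scoped Classical

open NumberField WeierstrassCurve Literature.NumberTheory.EllipticCurves
  Literature.NumberTheory.EllipticCurves.ModularForms

namespace Literature.NumberTheory.EllipticCurves.KrizLi2019

/-! ### §1 The printed side data: `|Ẽ^{ns}(𝔽_ℓ)|`, the prime set `ℓ ∣ pNN′/M`, the Euler-type factor -/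

section Data

variable (p : ℕ) (W G : WeierstrassCurve ℚ)

/-- **`|Ẽ^{ns}(𝔽_ℓ)|` as the integer `ℓ + [ℓ ∤ N] − a_ℓ(E)`** for a globally minimal `W/ℚ`: `ℓ + 1 − a_ℓ`
(good), `ℓ − a_ℓ` with `a_ℓ = ±1` (multiplicative: `ℓ ∓ 1`), `ℓ` (additive, `a_ℓ = 0`), where
`a_ℓ = W.LFunction ℓ` is the Dirichlet coefficient of `L(E, s)` — Kriz–Li Rem. 1.17, in the explicit
form of the Euler factors of Thm. 3.9 at `χ = 1` (`(ℓ − a_ℓ(f) + 1)/ℓ` for `ℓ ∤ N`, `(ℓ − a_ℓ(f))/ℓ` for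
`ℓ ∣ N`). Same body as the O5 node file's `nsCount` (so equal to it by `rfl`). A definition; nothing
asserted. [cite: KrizLi2019, Rem. 1.17 and Thm. 3.9 (FMS 7 (2019) e15; = arXiv:1606.03172 Rem. 1.9, text chunk p0004 L12–L13, and Thm. 2.9, chunk p0011 L3–L12)] -/
def nsPointCount (ℓ : ℕ) : ℤ :=
  (ℓ : ℤ) + (if h : ℓ.Prime then (haveI := Fact.mk h; if W.HasGoodReductionAtPrime ℓ then 1 else 0)
    else 0) - W.LFunction ℓ

/-- **The primes `ℓ ∣ pNN′/M`** of Kriz–Li Thm. 1.16 at `m = 1` for the ordered pair `(W, G)` of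
globally minimal curves of conductors `N = N_W`, `N′ = N_G`: the prime factors `ℓ` of `p·N·N′` that
are NOT in `M = ∏_{ℓ ∣ (N,N′), a_ℓ(E) ≡ a_ℓ(E′) (mod p)} ℓ^{ord_ℓ(NN′)}`, together with `ℓ = p` itself
(which always divides `pNN′/M`: the extra factor `p`). Symmetric in `(W, G)`
(`depletionPrimes_comm`). Same body as the O5 node file's `klSet` at `p = 3`. A definition; nothing
asserted. [cite: KrizLi2019, Thm. 1.16 (FMS; the index set `ℓ ∣ pNN′/M` and the definition of `M`) = arXiv:1606.03172 Thm. 1.8 (text chunk p0004 L7–L10)] -/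
def depletionPrimes : Finset ℕ :=
  (p * W.conductorNorm ℤ * G.conductorNorm ℤ).primeFactors.filter fun ℓ =>
    ℓ = p ∨ ¬ (ℓ ∣ W.conductorNorm ℤ ∧ ℓ ∣ G.conductorNorm ℤ ∧
      ((W.LFunction ℓ : ℤ) : ZMod p) = ((G.LFunction ℓ : ℤ) : ZMod p))

/-- **The Euler-type factor `∏_{ℓ ∣ pNN′/M} |Ẽ^{ns}(𝔽_ℓ)|/ℓ ∈ ℚ`** on the `E`-side of Kriz–Li Thm. 1.16
(`m = 1`) for the pair `(W, G)` ("the result of removing the Euler factors of `L(E,1)` … at bad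
primes", Rem. 1.17). A definition; nothing asserted. [cite: KrizLi2019, Thm. 1.16 and Rem. 1.17 (FMS) = arXiv:1606.03172 Thm. 1.8 / Rem. 1.9 (text chunk p0004 L7–L13)] -/
def eulerFactor : ℚ :=
  ∏ ℓ ∈ depletionPrimes p W G, (nsPointCount W ℓ : ℚ) / ℓ

/-- **`ord_p ∏_{ℓ ∣ pNN′/M} |Ẽ^{ns}(𝔽_ℓ)|/ℓ` as Kriz–Li read it**: `∑_{ℓ} (ord_p |Ẽ^{ns}(𝔽_ℓ)| − [ℓ = p])`
(the `/ℓ` is a `p`-adic unit for `ℓ ≠ p` and contributes `−1` at `ℓ = p`). Equal to the valuation of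
`eulerFactor p W G` in `ℚ_p` whenever that factor is non-zero (`valuation_eulerFactor`). Same body as
the O5 node file's `klExponent` at `p = 3`. A definition; nothing asserted.
[cite: KrizLi2019, Thm. 1.16 and Rem. 1.17 (FMS), with the sentence after Rem. 1.19 ("as long as the extra Euler factors are p-adic units")] -/
def eulerFactorOrd : ℤ :=
  ∑ ℓ ∈ depletionPrimes p W G, (padicValInt p (nsPointCount W ℓ) - if ℓ = p then 1 else 0)

end Data

/-! ### §2 The named fact: Theorem 1.16 at `m = 1` -/

section Fact

/-- **Kriz–Li 2019, Theorem 1.16 at `m = 1` (the main congruence between `p`-adic logarithms of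
Heegner points), with Remark 1.17 (the factors).** For a prime `p`; globally minimal elliptic curves
`W, G /ℚ` of conductors `N, N′` whose Dirichlet coefficients satisfy `a_ℓ(W) ≡ a_ℓ(G) (mod p)` for
every prime `ℓ ∤ pNN′` (the printed hypothesis `E[p]^{ss} ≅ E′[p]^{ss}` in the form the proof uses,
§3.1; equivalent to it at `m = 1`); modular parametrisation data `D`, `D′` at levels `N`, `N′`
(`D.maninConstant = c` with `ω_𝓔 = c · ω_E`); an imaginary quadratic field `K` satisfying the
Heegner hypothesis for `N` and for `N′` in which `p` splits, read `p`-adically through an embedding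
`ιp : K →+* ℚ_p`; Heegner data `H`, `H′` of levels `N`, `N′` and discriminant `d_K`, a complex
embedding `ι` and the Heegner points `P ∈ W(K)`, `P′ ∈ G(K)` (`ι(P) = heegnerPointComplex D H`,
`ι(P′) = heegnerPointComplex D′ H′`): **there is a sign `ε = ±1` with
`(∏_{ℓ ∣ pNN′/M} |W̃^{ns}(𝔽_ℓ)|/ℓ) · log_{ω_W} P ≡ ε · (∏_{ℓ ∣ pNN′/M} |G̃^{ns}(𝔽_ℓ)|/ℓ) · log_{ω_G} P′
(mod p ℤ_p)`**, where `log_{ω_W} P = padicLogOmega W p ιp P / D.maninConstant` (Néron-normalised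
`ℤ_p`-linear formal logarithm divided by the constant of the parametrisation, §1.4 / Rem. 3.10) and
"`x ≡ y (mod p ℤ_p)`" is `‖x − y‖_p ≤ p⁻¹`. NO hypothesis on the reduction of `W` or `G` at `p`
(§1.6 applies it at an additive `p = 3`). Named fact (PUBLISHED, refereed); nothing asserted; users
take `(h : thm116_padicLogHeegner_congruence)`. -- TODO(general form): `m ≥ 2`; Thm. 3.9.
[cite: KrizLi2019, Thm. 1.16 with Rem. 1.17, §1.4 and Rem. 3.10–3.11 (Forum Math. Sigma 7 (2019) e15, doi 10.1017/fms.2019.9; = arXiv:1606.03172 Thm. 1.8, text chunk p0004 L3–L13, Rem. 2.10–2.11, chunk p0013 L13–L16)] -/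
def thm116_padicLogHeegner_congruence : Prop :=
  ∀ (p : ℕ) [Fact p.Prime] (W G : WeierstrassCurve ℚ) [W.IsElliptic] [W.IsGloballyMinimal]
    [G.IsElliptic] [G.IsGloballyMinimal] [NeZero (W.conductorNorm ℤ)] [NeZero (G.conductorNorm ℤ)],
    (∀ ℓ : ℕ, ℓ.Prime → ¬ (ℓ ∣ p * W.conductorNorm ℤ * G.conductorNorm ℤ) →
      ((W.LFunction ℓ : ℤ) : ZMod p) = ((G.LFunction ℓ : ℤ) : ZMod p)) →
    ∀ (D : ModularParametrizationData W (W.conductorNorm ℤ))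
      (D' : ModularParametrizationData G (G.conductorNorm ℤ))
      (K : Type) [Field K] [NumberField K], IsImaginaryQuadratic K →
      SatisfiesHeegnerHypothesis (W.conductorNorm ℤ) K →
      SatisfiesHeegnerHypothesis (G.conductorNorm ℤ) K →
      ((Ideal.span {(p : ℤ)}).primesOver (𝓞 K)).ncard = 2 →
    ∀ (H : HeegnerDatum (W.conductorNorm ℤ) (NumberField.discr K))
      (H' : HeegnerDatum (G.conductorNorm ℤ) (NumberField.discr K)) (ι : K →+* ℂ) (ιp : K →+* ℚ_[p])
      (P : (W.baseChange K).toAffine.Point) (P' : (G.baseChange K).toAffine.Point),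
      WeierstrassCurve.Affine.Point.map ι.toRatAlgHom P = heegnerPointComplex D H →
      WeierstrassCurve.Affine.Point.map ι.toRatAlgHom P' = heegnerPointComplex D' H' →
    ∃ ε : ℤ, (ε = 1 ∨ ε = -1) ∧
      ‖((eulerFactor p W G : ℚ) : ℚ_[p]) *
            (Castella2018.padicLogOmega W p ιp P / (D.maninConstant : ℚ_[p])) -
          (ε : ℚ_[p]) * (((eulerFactor p G W : ℚ) : ℚ_[p]) *
            (Castella2018.padicLogOmega G p ιp P' / (D'.maninConstant : ℚ_[p])))‖ ≤ (p : ℝ)⁻¹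

end Fact

/-! ### §3 Proved API: the prime set, the valuation of the factor, and the valuation corollary
(`ord_p X = 0 ↔ ord_p X′ = 0`, the form in which the O5 node KL3-A consumes Theorem 1.16) -/

section API

variable (p : ℕ) (W G : WeierstrassCurve ℚ)

/-- The prime set `ℓ ∣ pNN′/M` is symmetric in the pair `(E, E′)` (the set and `M` are).
[cite: KrizLi2019, Thm. 1.16 (FMS) (the definition of `M` is symmetric in `E`, `E′`)] -/
theorem depletionPrimes_comm : depletionPrimes p W G = depletionPrimes p G W := by
  unfold depletionPrimes
  rw [mul_right_comm]
  refine Finset.filter_congr fun ℓ _ => ?_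
  constructor
  · rintro (h | h)
    · exact Or.inl h
    · exact Or.inr fun ⟨a, b, c⟩ => h ⟨b, a, c.symm⟩
  · rintro (h | h)
    · exact Or.inl h
    · exact Or.inr fun ⟨a, b, c⟩ => h ⟨b, a, c.symm⟩

variable {p W G} in
/-- Members of the prime set are primes dividing `p·N·N′`. [cite: KrizLi2019, Thm. 1.16 (FMS) (the index set `ℓ ∣ pNN′/M`)] -/
theorem prime_of_mem_depletionPrimes {ℓ : ℕ} (h : ℓ ∈ depletionPrimes p W G) :
    ℓ.Prime ∧ ℓ ∣ p * W.conductorNorm ℤ * G.conductorNorm ℤ := by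
  have h' := (Finset.mem_filter.mp h).1
  exact ⟨Nat.prime_of_mem_primeFactors h', Nat.dvd_of_mem_primeFactors h'⟩

/-- `p` itself always belongs to the prime set (the extra factor `p` in `pNN′/M`), for a prime `p` and
non-zero conductors. [cite: KrizLi2019, Thm. 1.16 (FMS) (the factor `p` of `pNN′/M`); Rem. 3.10] -/
theorem self_mem_depletionPrimes [Fact p.Prime] [NeZero (W.conductorNorm ℤ)]
    [NeZero (G.conductorNorm ℤ)] : p ∈ depletionPrimes p W G := by
  refine Finset.mem_filter.mpr ⟨Nat.mem_primeFactors.mpr ⟨Fact.out, ?_, ?_⟩, Or.inl rfl⟩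
  · exact dvd_mul_of_dvd_left (dvd_mul_right p _) _
  · exact mul_ne_zero (mul_ne_zero (Fact.out : p.Prime).ne_zero (NeZero.ne _)) (NeZero.ne _)

variable {p} in
/-- `ord_p` of a finite product of non-zero rationals is the sum of the `ord_p`. [folklore] -/
private theorem padicValRat_finset_prod [Fact p.Prime] {α : Type*} (s : Finset α) (f : α → ℚ)
    (hf : ∀ i ∈ s, f i ≠ 0) : padicValRat p (∏ i ∈ s, f i) = ∑ i ∈ s, padicValRat p (f i) := by
  induction s using Finset.induction_on with
  | empty => simp
  | insert a s ha ih =>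
    rw [Finset.prod_insert ha, Finset.sum_insert ha,
      padicValRat.mul (hf a (Finset.mem_insert_self a s))
        (Finset.prod_ne_zero_iff.mpr fun i hi => hf i (Finset.mem_insert_of_mem hi)),
      ih fun i hi => hf i (Finset.mem_insert_of_mem hi)]

/-- **`ord_p ∏_{ℓ ∣ pNN′/M} |Ẽ^{ns}(𝔽_ℓ)|/ℓ = ∑_ℓ (ord_p |Ẽ^{ns}(𝔽_ℓ)| − [ℓ = p])`** whenever the factor is
non-zero (each `|Ẽ^{ns}(𝔽_ℓ)| ≠ 0`): the valuation of `eulerFactor` read in `ℚ_p` is `eulerFactorOrd`.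
[cite: KrizLi2019, Thm. 1.16 and Rem. 1.17 (FMS) (the Euler-type factor and its `p`-adic valuation)] -/
theorem valuation_eulerFactor [Fact p.Prime] (h0 : eulerFactor p W G ≠ 0) :
    ((eulerFactor p W G : ℚ) : ℚ_[p]).valuation = eulerFactorOrd p W G := by
  rw [Padic.valuation_ratCast]
  unfold eulerFactor at h0 ⊢
  unfold eulerFactorOrd
  have hne : ∀ ℓ ∈ depletionPrimes p W G, (nsPointCount W ℓ : ℚ) / ℓ ≠ 0 :=
    fun ℓ hℓ ↦ Finset.prod_ne_zero_iff.mp h0 ℓ hℓ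
  rw [padicValRat_finset_prod _ _ hne]
  refine Finset.sum_congr rfl fun ℓ hℓ ↦ ?_
  have hℓp : ℓ.Prime := (prime_of_mem_depletionPrimes hℓ).1
  have hℓ0 : (ℓ : ℚ) ≠ 0 := by exact_mod_cast hℓp.ne_zero
  have hn0 : (nsPointCount W ℓ : ℚ) ≠ 0 := by
    intro h
    exact hne ℓ hℓ (by rw [h, zero_div])
  rw [padicValRat.div hn0 hℓ0, padicValRat.of_int, padicValRat.of_nat]
  congr 1
  by_cases hℓe : ℓ = p
  · subst hℓe
    rw [if_pos rfl, padicValNat_self, Nat.cast_one]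
  · haveI : Fact ℓ.Prime := ⟨hℓp⟩
    rw [if_neg hℓe, padicValNat_primes (Ne.symm hℓe), Nat.cast_zero]

variable {p} in
/-- Ultrametric step: if `X ≡ ε X′ (mod p ℤ_p)` with `ε = ±1` and `X` is a `p`-adic unit then so is
`X′`. [folklore] -/
private theorem norm_eq_one_of_norm_sub_le [Fact p.Prime] {X Y : ℚ_[p]} {ε : ℤ}
    (hε : ε = 1 ∨ ε = -1) (h : ‖X - (ε : ℚ_[p]) * Y‖ ≤ (p : ℝ)⁻¹) (hX : ‖X‖ = 1) : ‖Y‖ = 1 := by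
  have hεn : ‖(ε : ℚ_[p])‖ = 1 := by
    rcases hε with rfl | rfl <;> simp
  have hp1 : (1 : ℝ) < p := by exact_mod_cast (Fact.out : p.Prime).one_lt
  have hlt : ‖X - (ε : ℚ_[p]) * Y‖ < ‖X‖ := by
    rw [hX]
    exact lt_of_le_of_lt h (inv_lt_one_of_one_lt₀ hp1)
  have hne : ‖X‖ ≠ ‖-(X - (ε : ℚ_[p]) * Y)‖ := by
    rw [norm_neg]
    exact (ne_of_lt hlt).symm
  have hmax := Padic.add_eq_max_of_ne hne
  rw [show X + -(X - (ε : ℚ_[p]) * Y) = (ε : ℚ_[p]) * Y by ring, norm_neg,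
    max_eq_left hlt.le, norm_mul, hεn, one_mul, hX] at hmax
  exact hmax

variable {p} in
/-- `X ≡ ε X′ (mod p)` with `ε = ±1` is symmetric: `X′ ≡ ε X (mod p)`. [folklore] -/
private theorem norm_sub_mul_comm [Fact p.Prime] {X Y : ℚ_[p]} {ε : ℤ} (hε : ε = 1 ∨ ε = -1) :
    ‖Y - (ε : ℚ_[p]) * X‖ = ‖X - (ε : ℚ_[p]) * Y‖ := by
  rcases hε with rfl | rfl
  · simp only [Int.cast_one, one_mul]
    exact norm_sub_rev Y X
  · simp only [Int.cast_neg, Int.cast_one, neg_mul, one_mul, sub_neg_eq_add]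
    rw [add_comm]

variable {p} in
/-- For `x ≠ 0` in `ℚ_p`: `‖x‖ = 1 ↔ ord_p x = 0`. [folklore] -/
private theorem norm_eq_one_iff_valuation_eq_zero [Fact p.Prime] {x : ℚ_[p]} (hx : x ≠ 0) :
    ‖x‖ = 1 ↔ x.valuation = 0 := by
  have hp0 : (0 : ℝ) < p := by exact_mod_cast (Fact.out : p.Prime).pos
  have hp1 : (p : ℝ) ≠ 1 := by exact_mod_cast (Fact.out : p.Prime).ne_one
  rw [Padic.norm_eq_zpow_neg_valuation hx, ← zpow_zero (p : ℝ), zpow_right_inj₀ hp0 hp1,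
    neg_eq_zero]

/-- **The valuation corollary of Theorem 1.16 (`m = 1`) — the shape of the O5 node KL3-A.** Under the
fact and its hypotheses, if both logarithms `log_{ω_𝓔} P`, `log_{ω_𝓔′} P′` are non-zero (e.g. `P`,
`P′` of infinite order), both Euler-type factors are non-zero (Hasse) and both constants `c`, `c′`
are non-zero, then
`ord_p(∏|W̃^{ns}|/ℓ) + ord_p log_{ω_𝓔} P − ord_p c = 0 ↔ ord_p(∏|G̃^{ns}|/ℓ) + ord_p log_{ω_𝓔′} P′ − ord_p c′ = 0`:
a `p`-adic unit is congruent mod `p` only to `p`-adic units ("Theorem 1.16 allows us to propagate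
the nonvanishing (mod `p`) of the `p`-adic logarithm of Heegner points through congruences as long
as the extra Euler factors are `p`-adic units", the sentence after Rem. 1.19). PROVED from the named
fact; the side conditions are binders, not facts.
[cite: KrizLi2019, Thm. 1.16 (FMS) with the sentence following Rem. 1.19 (chunk p0002 L9)] -/
theorem eulerFactorOrd_add_padicLogOrd_sub_eq_zero_iff_of_thm116
    (h : thm116_padicLogHeegner_congruence) [Fact p.Prime] [W.IsElliptic] [W.IsGloballyMinimal]
    [G.IsElliptic] [G.IsGloballyMinimal] [NeZero (W.conductorNorm ℤ)] [NeZero (G.conductorNorm ℤ)]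
    (hcong : ∀ ℓ : ℕ, ℓ.Prime → ¬ (ℓ ∣ p * W.conductorNorm ℤ * G.conductorNorm ℤ) →
      ((W.LFunction ℓ : ℤ) : ZMod p) = ((G.LFunction ℓ : ℤ) : ZMod p))
    (D : ModularParametrizationData W (W.conductorNorm ℤ))
    (D' : ModularParametrizationData G (G.conductorNorm ℤ))
    (K : Type) [Field K] [NumberField K] (hK : IsImaginaryQuadratic K)
    (hH : SatisfiesHeegnerHypothesis (W.conductorNorm ℤ) K)
    (hH' : SatisfiesHeegnerHypothesis (G.conductorNorm ℤ) K)
    (hsplit : ((Ideal.span {(p : ℤ)}).primesOver (𝓞 K)).ncard = 2)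
    (H : HeegnerDatum (W.conductorNorm ℤ) (NumberField.discr K))
    (H' : HeegnerDatum (G.conductorNorm ℤ) (NumberField.discr K)) (ι : K →+* ℂ) (ιp : K →+* ℚ_[p])
    (P : (W.baseChange K).toAffine.Point) (P' : (G.baseChange K).toAffine.Point)
    (hP : WeierstrassCurve.Affine.Point.map ι.toRatAlgHom P = heegnerPointComplex D H)
    (hP' : WeierstrassCurve.Affine.Point.map ι.toRatAlgHom P' = heegnerPointComplex D' H')
    (hEW : eulerFactor p W G ≠ 0) (hEG : eulerFactor p G W ≠ 0)
    (hLW : Castella2018.padicLogOmega W p ιp P ≠ 0) (hLG : Castella2018.padicLogOmega G p ιp P' ≠ 0)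
    (hcW : D.maninConstant ≠ 0) (hcG : D'.maninConstant ≠ 0) :
    eulerFactorOrd p W G + padicLogOrd W p ιp P - padicValInt p D.maninConstant = 0 ↔
      eulerFactorOrd p G W + padicLogOrd G p ιp P' - padicValInt p D'.maninConstant = 0 := by
  obtain ⟨ε, hε, hle⟩ := h p W G hcong D D' K hK hH hH' hsplit H H' ι ιp P P' hP hP'
  set X : ℚ_[p] := ((eulerFactor p W G : ℚ) : ℚ_[p]) *
    (Castella2018.padicLogOmega W p ιp P / (D.maninConstant : ℚ_[p])) with hXdef
  set X' : ℚ_[p] := ((eulerFactor p G W : ℚ) : ℚ_[p]) *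
    (Castella2018.padicLogOmega G p ιp P' / (D'.maninConstant : ℚ_[p])) with hX'def
  have hEW' : ((eulerFactor p W G : ℚ) : ℚ_[p]) ≠ 0 := by exact_mod_cast hEW
  have hEG' : ((eulerFactor p G W : ℚ) : ℚ_[p]) ≠ 0 := by exact_mod_cast hEG
  have hcW' : (D.maninConstant : ℚ_[p]) ≠ 0 := by exact_mod_cast hcW
  have hcG' : (D'.maninConstant : ℚ_[p]) ≠ 0 := by exact_mod_cast hcG
  have hX0 : X ≠ 0 := mul_ne_zero hEW' (div_ne_zero hLW hcW')
  have hX'0 : X' ≠ 0 := mul_ne_zero hEG' (div_ne_zero hLG hcG')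
  have hvX : X.valuation =
      eulerFactorOrd p W G + padicLogOrd W p ιp P - padicValInt p D.maninConstant := by
    rw [hXdef, Padic.valuation_mul hEW' (div_ne_zero hLW hcW'), valuation_eulerFactor p W G hEW,
      div_eq_mul_inv, Padic.valuation_mul hLW (inv_ne_zero hcW'),
      Castella2018.valuation_padicLogOmega hLW, Padic.valuation_inv, Padic.valuation_intCast]
    ring
  have hvX' : X'.valuation =
      eulerFactorOrd p G W + padicLogOrd G p ιp P' - padicValInt p D'.maninConstant := by
    rw [hX'def, Padic.valuation_mul hEG' (div_ne_zero hLG hcG'), valuation_eulerFactor p G W hEG,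
      div_eq_mul_inv, Padic.valuation_mul hLG (inv_ne_zero hcG'),
      Castella2018.valuation_padicLogOmega hLG, Padic.valuation_inv, Padic.valuation_intCast]
    ring
  have hle' : ‖X' - (ε : ℚ_[p]) * X‖ ≤ (p : ℝ)⁻¹ := by
    rw [norm_sub_mul_comm hε]
    exact hle
  rw [← hvX, ← hvX', ← norm_eq_one_iff_valuation_eq_zero hX0,
    ← norm_eq_one_iff_valuation_eq_zero hX'0]
  exact ⟨norm_eq_one_of_norm_sub_le hε hle, norm_eq_one_of_norm_sub_le hε hle'⟩

end API

end Literature.NumberTheory.EllipticCurves.KrizLi2019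

end
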